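/-
Copyright (c) 2026 the pub-hodgecm-mathlib formalisation cell (harness21).  Prover seat hodgecm-mathlib-B-p14 (g32) — heir of the (R2) glue
(B-p14 (g31) ★ p842588 ∕ p842603 ∕ p842953), 2026-09-01.  THE (R2) PER-PLACE ASSEMBLY at an UNRAMIFIED non-split place, for
`stub_N6nsR2EP : RankOneEulerPoincareNonsplit` (pen F0P2-p02 (g9), line «N6nsGerm»; LEAD F0P3a-plan (g10) T9-8 (C)).
-/
import Literature.NumberTheory.Rogawski1990.RankOneEulerPoincareGlueRankOne              -- ★ (B-p14 g31) `exists_isLocSmooth_classOrbitalIntegral_eq_one_zero_of_relations_two` (the glue on `U₂`)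
import Literature.NumberTheory.Automorphic.UnitaryTwoEulerPoincareNonEllipticRelation      -- ★ (B-p10) `epNonEllipticRelation` (`hN`), the levels `K′ := Ad_d K`, `I := K ⊓ K′` through the one-place model
import Literature.NumberTheory.Automorphic.UnitaryTwoEulerPoincareEllipticTypeOne          -- ★ (B-p14 g32, R5c) `natCard_fixedBy_add_eq_natCard_fixedBy_add_one_of_eigenframe` (type-(1) `(E)` on `U₂`)
import Literature.NumberTheory.Rogawski1990.FinExplicitTransferFactorInertExponent          -- ★ `exists_nat_valued_eq_exp_neg` (`ord_w` of an integral element)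
import HarnessLib

/-!
# The Euler–Poincaré relations on `U(Φ₂)(L⁺_v)` at an unramified non-split place, assembled (modulo the type-(2) elliptic count)

Topic `NumberTheory/Rogawski1990`, namespaces `Literature.NumberTheory.Automorphic.UnitaryGroup` (§1) and `Literature.NumberTheory.Rogawski1990` (§2–§3).
THEOREMS ONLY: no definition, no named fact, no instance, no notation, no `sorry`; kernel lane.

THE ASSEMBLY.  `L` CM, `v` a finite place of `L⁺` UNRAMIFIED and NON-SPLIT in `L` (`w ∣ v`, `w̄ = w`), `ϖ ∈ L_w^×` a `σ_w`-fixed uniformiser,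
`d = diag(1, ϖ)`, and on `U₂ := U(Φ₂)(L⁺_v) = (cmDatum L 2 Φ₂).Local v` Kottwitz's three levels [Kottwitz1988, §2]: `K := U(Φ₂)(𝒪_v)`
(★ `cmLocalIntegralLevel`), `K′ := Ad_d K` (`= K.map e_d`, ★ B-p10), `I := K ⊓ K′` (the Iwahori).  The (R2) glue ★
`exists_isLocSmooth_classOrbitalIntegral_eq_one_zero_of_relations_two` turns the two relations
 (E) `#Fix(U₂⧸K, γ) + #Fix(U₂⧸K′, γ) = #Fix(U₂⧸I, γ) + 1` for every regular ELLIPTIC `γ` (compact centraliser), and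
 (N) `(vol K)⁻¹Φ(⟦γ⟧,𝟙_K) + (vol K′)⁻¹Φ(⟦γ⟧,𝟙_{K′}) − (vol I)⁻¹Φ(⟦γ⟧,𝟙_I) = 0` for every regular NON-ELLIPTIC `γ`
into Kottwitz's Euler–Poincaré function `f_EP` (`Φ(⟦γ⟧, f_EP) = 1 ∕ 0`).  HERE: (N) is ★ B-p10 `epNonEllipticRelation`; (E) splits by ★ B-p14 (g31)
`not_exists_isRoot_or_exists_eigenframe_of_compactSpace_centralizer` into TYPE (1) (eigenframe over `L_w`, `u₀ ≠ u₁` of norm one) — discharged by ★ (R5c)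
`natCard_fixedBy_add_eq_natCard_fixedBy_add_one_of_eigenframe` after reading the eigenframe at `w` (§1: the frame `P(w)`, `Injective (u · w)` at the one
place `w`, and `|u₀(w) − u₁(w)| = |ϖ_v^N|` for some `N`) — and TYPE (2) (`χ_{γ,w}` rootless in `L_w`), which enters as ONE NAMED BINDER `hE₂` in the
glue's own shape (B-p08 (g28)'s (R2-t2) road ∕ A-p17 (g22)'s type-blind tree relation ★ `natCard_fixedBy_add_eq_natCard_fixedBy_add_one_congr`
discharge it).  OUTPUT (§2): the relations package `∃ K K′ I, open ∧ compact ×3 ∧ (E) ∧ (N)` = the per-place hypothesis of ★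
`rankOneEulerPoincareNonsplit_of_relations` at `(L, v)`, in two entry shapes — `…_of_ellipticRelation` (from (E) at the three concrete levels for ALL
regular elliptic `γ`, no unramifiedness used) and `…_of_typeTwo` (from `hE₂` alone, `v` unramified); (§3): the Euler–Poincaré function at `v`
(`∃ f, IsLocSmooth f ∧ Φ(elliptic) = 1 ∧ Φ(non-elliptic) = 0`) in the same two shapes.  The ramified non-split places are A-p06 (g27)'s (R2-ram) road;
`RankOneEulerPoincareNonsplit` itself follows from the per-place packages by ★ `rankOneEulerPoincareNonsplit_of_relations`.
HONEST LABEL: HC_CM is proved only modulo the cell's remaining named inputs (hLiu418, h413) until rung 0 closes; this file is unconditional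
(its elliptic ∕ type-(2) inputs are hypotheses, not `sorry`s).

## References
* [Kottwitz1988] R. E. Kottwitz, *Tamagawa numbers*, Ann. of Math. 127 (1988), 629–646, §2 Theorem 2.
* [Rogawski1990] J. D. Rogawski, *Automorphic Representations of Unitary Groups in Three Variables* (1990), §12.6–12.7 pp. 174–176.
* [Serre1980Trees] J.-P. Serre, *Trees* (1980), Ch. II §1.1.
-/

set_option autoImplicit false

noncomputable section

open scoped ValuativeRel Matrix MatrixGroups
open Matrix ValuativeRel NumberField IsDedekindDomain MulAction MeasureTheory Measure

namespace Literature.NumberTheory.Automorphic.UnitaryGroup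

open Literature.NumberTheory.Rogawski1990 Literature.NumberTheory.GaloisRepresentations

/-! ## §1 Reading a type-(1) eigenframe of `γ ∈ U(Φ₂)(L⁺_v)` at the place `w` -/

section TypeOneAtW

variable (L : Type) [Field L] [NumberField L] [IsCMField L] (v : HeightOneSpectrum (𝓞 ↥(maximalRealSubfield L)))
  (w : PlacesOver L v) (hw : IsCMField.complexConj L • w.1 = w.1)

include hw in
/-- **`|u₀ − u₁| = |ϖ_v^N|` for some `N`**, for distinct norm-one `u₀, u₁ ∈ L_w` at a place `v` unramified in `L` (`uᵢ ∈ 𝒪_w^×`, so `u₀ − u₁` is a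
non-zero integer; `ι_w(ϖ_v)` is a uniformiser of `L_w` ★ `valued_toPlace_uniformizer`). [cite: Rogawski1990, §12.6 p. 174] [cite: Kottwitz1988, §2] -/
theorem exists_valuation_sub_eq_valuation_toPlace_uniformizer_pow (hunr : Algebra.IsUnramifiedIn (𝓞 L) v.asIdeal)
    {u₀ u₁ : w.1.adicCompletion L} (h₀ : galAdicCompletionMap (L := L) (IsCMField.complexConj L) hw u₀ * u₀ = 1)
    (h₁ : galAdicCompletionMap (L := L) (IsCMField.complexConj L) hw u₁ * u₁ = 1) (hne : u₀ ≠ u₁) :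
    ∃ N : ℕ, valuation (w.1.adicCompletion L) (u₀ - u₁) =
      valuation (w.1.adicCompletion L) (toPlace v w (HeckeCharacter.uniformizer ↥(maximalRealSubfield L) v : v.adicCompletion ↥(maximalRealSubfield L)) ^ N) := by
  have hv₀ : Valued.v u₀ = 1 := (v_eq_one_iff_valuation_eq_one u₀).2 (valuation_eq_one_of_galAdicCompletionMap_mul_self L v w hw h₀)
  have hv₁ : Valued.v u₁ = 1 := (v_eq_one_iff_valuation_eq_one u₁).2 (valuation_eq_one_of_galAdicCompletionMap_mul_self L v w hw h₁)
  have hle : Valued.v (u₀ - u₁) ≤ 1 := by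
    refine (Valuation.map_sub _ u₀ u₁).trans ?_
    rw [hv₀, hv₁, max_self]
  obtain ⟨N, hN⟩ := exists_nat_valued_eq_exp_neg L v w (sub_ne_zero.2 hne) hle
  refine ⟨N, (v_eq_iff_valuation_eq _ _).1 ?_⟩
  rw [hN, map_pow, valued_toPlace_uniformizer L v w hunr, ← WithZero.exp_nsmul, nsmul_eq_mul, mul_neg, mul_one]

include hw in
/-- **A type-(1) eigenframe over `L ⊗ L⁺_v` read at `w`**: if `γ_v P = P diag(u)` over `LocalRing L v = Π_{w′ ∣ v} L_{w′}` with `u₀ ≠ u₁` of norm one, then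
the one-place image `γ_w = e_w γ` (★ `localNonsplitEquiv`, entrywise evaluation at `w` — ★ `coe_localNonsplitEquiv_apply`) has the eigenframe `P(w)`,
eigenvalues `uᵢ(w)` distinct (one place above `v`) of norm one for `σ_w`. [cite: Rogawski1990, §3.6 pp. 31–32] [cite: PlatonovRapinchuk1994, §5.1] -/
theorem exists_eigenframe_localNonsplitEquiv_of_eigenframe
    (γ : (cmDatum L 2 (Matrix.of fun i j : Fin 2 => if i.val + j.val + 1 = 2 then (1 : L) else 0)).Local v)
    {P : GL (Fin 2) (LocalRing L v)} {u : Fin 2 → LocalRing L v}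
    (hP : γ.val.val * P.val = P.val * diagonal u) (hu : Function.Injective u)
    (hu1 : ∀ i, conjLocal L (IsCMField.complexConj L) v (u i) * u i = 1) :
    ∃ (Pw : GL (Fin 2) (w.1.adicCompletion L)) (uw : Fin 2 → w.1.adicCompletion L),
      (((localNonsplitEquiv (IsCMField.complexConj L) (Matrix.of fun i j : Fin 2 => if i.val + j.val + 1 = 2 then (1 : L) else 0)
          (IsCMField.complexConj_ne_one L) w hw γ :
          unitaryGroupOfForm (galAdicCompletionMap (L := L) (IsCMField.complexConj L) hw)
            (placeForm (Matrix.of fun i j : Fin 2 => if i.val + j.val + 1 = 2 then (1 : L) else 0) w.1)) :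
          GL (Fin 2) (w.1.adicCompletion L)) : Matrix (Fin 2) (Fin 2) (w.1.adicCompletion L)) * Pw = Pw * diagonal uw ∧
      Function.Injective uw ∧ ∀ i, galAdicCompletionMap (L := L) (IsCMField.complexConj L) hw (uw i) * uw i = 1 := by
  haveI : Algebra.IsQuadraticExtension ↥(maximalRealSubfield L) L := IsCMField.isQuadraticExtension L
  have hc1 : IsCMField.complexConj L ≠ 1 := IsCMField.complexConj_ne_one L
  let φ : LocalRing L v →+* w.1.adicCompletion L := Pi.evalRingHom (fun w' : PlacesOver L v => w'.1.adicCompletion L) w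
  refine ⟨Matrix.GeneralLinearGroup.map φ P, fun i => u i w, ?_, ?_, ?_⟩
  · have h := congrArg (fun M : Matrix (Fin 2) (Fin 2) (LocalRing L v) => M.map φ) hP
    simp only [Matrix.map_mul, Matrix.diagonal_map (map_zero φ)] at h
    exact h
  · intro i j hij
    exact hu ((LocalRing.eq_iff_apply_eq (IsCMField.complexConj L) hc1 w hw (u i) (u j)).2 hij)
  · intro i
    have h := congrFun (hu1 i) w
    rw [Pi.mul_apply, conjLocal_apply_eq_galAdicCompletionMap L v w hw] at h
    exact h

end TypeOneAtW

end Literature.NumberTheory.Automorphic.UnitaryGroup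

namespace Literature.NumberTheory.Rogawski1990

open Literature.NumberTheory.Automorphic Literature.NumberTheory.Automorphic.UnitaryGroup Literature.NumberTheory.GaloisRepresentations

/-! ## §2 The relations package at a non-split place: from (E) at the concrete levels, and from the type-(2) count alone -/

section Assembly

variable (L : Type) [Field L] [NumberField L] [IsCMField L] {v : HeightOneSpectrum (𝓞 ↥(maximalRealSubfield L))}
  (w : PlacesOver L v) (hw : IsCMField.complexConj L • w.1 = w.1)
  (ϖ : (w.1.adicCompletion L)ˣ) (hϖ : Valued.v (ϖ : w.1.adicCompletion L) = WithZero.exp (-1 : ℤ))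
  (hσϖ : galAdicCompletionMap (L := L) (IsCMField.complexConj L) hw (ϖ : w.1.adicCompletion L) = ϖ)

include hw hϖ hσϖ in
/-- **(E) AT `K, K′ := Ad_d K, I := K ⊓ K′` FOR EVERY REGULAR ELLIPTIC `γ`, MODULO THE TYPE-(2) COUNT.**  `v` unramified non-split; `hE₂` = the relation for the
regular elliptic `γ` whose characteristic polynomial has no root in `L_w` (type (2)).  Then (E) holds for every regular elliptic `γ ∈ U(Φ₂)(L⁺_v)`: by ★
`not_exists_isRoot_or_exists_eigenframe_of_compactSpace_centralizer` the remaining `γ` are of type (1), where ★ (R5c)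
`natCard_fixedBy_add_eq_natCard_fixedBy_add_one_of_eigenframe` applies to the eigenframe read at `w` (§1). [cite: Kottwitz1988, §2 Theorem 2]
[cite: Rogawski1990, §12.6 p. 174; §12.7 Lemma 12.7.1 p. 176] -/
theorem epEllipticRelation_of_typeTwo (hunr : Algebra.IsUnramifiedIn (𝓞 L) v.asIdeal)
    (hE₂ : ∀ γ : (cmDatum L 2 (Matrix.of fun i j : Fin 2 => if i.val + j.val + 1 = 2 then (1 : L) else 0)).Local v,
      IsRegularElt (γ.val : GL (Fin 2) (UnitaryGroup.LocalRing L v)) →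
      CompactSpace (Subgroup.centralizer ({γ} : Set ((cmDatum L 2 (Matrix.of fun i j : Fin 2 => if i.val + j.val + 1 = 2 then (1 : L) else 0)).Local v))) →
      (¬ ∃ x : w.1.adicCompletion L, ((((γ.val : GL (Fin 2) (UnitaryGroup.LocalRing L v)) : Matrix (Fin 2) (Fin 2) (UnitaryGroup.LocalRing L v)).charpoly.map
        (Pi.evalRingHom (fun w' : PlacesOver L v => w'.1.adicCompletion L) w)).IsRoot x)) →
      Nat.card (fixedBy ((cmDatum L 2 (Matrix.of fun i j : Fin 2 => if i.val + j.val + 1 = 2 then (1 : L) else 0)).Local v ⧸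
          cmLocalIntegralLevel L 2 (Matrix.of fun i j : Fin 2 => if i.val + j.val + 1 = 2 then (1 : L) else 0) v) γ) +
        Nat.card (fixedBy ((cmDatum L 2 (Matrix.of fun i j : Fin 2 => if i.val + j.val + 1 = 2 then (1 : L) else 0)).Local v ⧸
          (cmLocalIntegralLevel L 2 (Matrix.of fun i j : Fin 2 => if i.val + j.val + 1 = 2 then (1 : L) else 0) v).map
            (cmDatumLocalNonsplitCongr L w hw (glDiagonal 2 (w.1.adicCompletion L) ![1, ϖ]) ϖ.isUnit
              (formCongr_glDiagonal_eq_smul_two L w hw ϖ hσϖ)).toMulEquiv.toMonoidHom) γ) =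
        Nat.card (fixedBy ((cmDatum L 2 (Matrix.of fun i j : Fin 2 => if i.val + j.val + 1 = 2 then (1 : L) else 0)).Local v ⧸
          (cmLocalIntegralLevel L 2 (Matrix.of fun i j : Fin 2 => if i.val + j.val + 1 = 2 then (1 : L) else 0) v ⊓
            (cmLocalIntegralLevel L 2 (Matrix.of fun i j : Fin 2 => if i.val + j.val + 1 = 2 then (1 : L) else 0) v).map
              (cmDatumLocalNonsplitCongr L w hw (glDiagonal 2 (w.1.adicCompletion L) ![1, ϖ]) ϖ.isUnit
                (formCongr_glDiagonal_eq_smul_two L w hw ϖ hσϖ)).toMulEquiv.toMonoidHom)) γ) + 1)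
    (γ : (cmDatum L 2 (Matrix.of fun i j : Fin 2 => if i.val + j.val + 1 = 2 then (1 : L) else 0)).Local v)
    (hreg : IsRegularElt (γ.val : GL (Fin 2) (UnitaryGroup.LocalRing L v)))
    (hc : CompactSpace (Subgroup.centralizer ({γ} : Set ((cmDatum L 2 (Matrix.of fun i j : Fin 2 => if i.val + j.val + 1 = 2 then (1 : L) else 0)).Local v)))) :
    Nat.card (fixedBy ((cmDatum L 2 (Matrix.of fun i j : Fin 2 => if i.val + j.val + 1 = 2 then (1 : L) else 0)).Local v ⧸
          cmLocalIntegralLevel L 2 (Matrix.of fun i j : Fin 2 => if i.val + j.val + 1 = 2 then (1 : L) else 0) v) γ) +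
        Nat.card (fixedBy ((cmDatum L 2 (Matrix.of fun i j : Fin 2 => if i.val + j.val + 1 = 2 then (1 : L) else 0)).Local v ⧸
          (cmLocalIntegralLevel L 2 (Matrix.of fun i j : Fin 2 => if i.val + j.val + 1 = 2 then (1 : L) else 0) v).map
            (cmDatumLocalNonsplitCongr L w hw (glDiagonal 2 (w.1.adicCompletion L) ![1, ϖ]) ϖ.isUnit
              (formCongr_glDiagonal_eq_smul_two L w hw ϖ hσϖ)).toMulEquiv.toMonoidHom) γ) =
      Nat.card (fixedBy ((cmDatum L 2 (Matrix.of fun i j : Fin 2 => if i.val + j.val + 1 = 2 then (1 : L) else 0)).Local v ⧸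
          (cmLocalIntegralLevel L 2 (Matrix.of fun i j : Fin 2 => if i.val + j.val + 1 = 2 then (1 : L) else 0) v ⊓
            (cmLocalIntegralLevel L 2 (Matrix.of fun i j : Fin 2 => if i.val + j.val + 1 = 2 then (1 : L) else 0) v).map
              (cmDatumLocalNonsplitCongr L w hw (glDiagonal 2 (w.1.adicCompletion L) ![1, ϖ]) ϖ.isUnit
                (formCongr_glDiagonal_eq_smul_two L w hw ϖ hσϖ)).toMulEquiv.toMonoidHom)) γ) + 1 := by
  rcases not_exists_isRoot_or_exists_eigenframe_of_compactSpace_centralizer L v w hw (antidiagOne_isHermitian L 2)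
      (isUnit_antidiagOne_det L 2).ne_zero γ hreg hc with hroot | ⟨P, u, hP, hu, hu1⟩
  · exact hE₂ γ hreg hc hroot
  · obtain ⟨Pw, uw, hPw, huw, huw1⟩ := exists_eigenframe_localNonsplitEquiv_of_eigenframe L v w hw γ hP hu hu1
    obtain ⟨N, hN⟩ := exists_valuation_sub_eq_valuation_toPlace_uniformizer_pow L v w hw hunr (huw1 0) (huw1 1)
      (fun h => (show (0 : Fin 2) ≠ 1 by decide) (huw h))
    exact natCard_fixedBy_add_eq_natCard_fixedBy_add_one_of_eigenframe L v w hw hunr ϖ hϖ hσϖ _ _ _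
      (fun g => mem_localIntegralLevel_iff_of_smul_eq (IsCMField.complexConj L) 2 _ (IsCMField.complexConj_ne_one L) w hw g)
      (mem_map_cmDatumLocalNonsplitCongr_cmLocalIntegralLevel_iff L w hw ϖ hσϖ)
      (mem_cmLocalIntegralLevel_inf_map_iff L w hw ϖ hϖ hσϖ) γ (P := Pw) hPw huw huw1 hN

variable
  [MeasurableSpace ((cmDatum L 2 (Matrix.of fun i j : Fin 2 => if i.val + j.val + 1 = 2 then (1 : L) else 0)).Local v)]
  [BorelSpace ((cmDatum L 2 (Matrix.of fun i j : Fin 2 => if i.val + j.val + 1 = 2 then (1 : L) else 0)).Local v)]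
  [∀ γ : (cmDatum L 2 (Matrix.of fun i j : Fin 2 => if i.val + j.val + 1 = 2 then (1 : L) else 0)).Local v,
    MeasurableSpace (((cmDatum L 2 (Matrix.of fun i j : Fin 2 => if i.val + j.val + 1 = 2 then (1 : L) else 0)).Local v) ⧸
      Subgroup.centralizer ({γ} : Set ((cmDatum L 2 (Matrix.of fun i j : Fin 2 => if i.val + j.val + 1 = 2 then (1 : L) else 0)).Local v)))]
  [∀ γ : (cmDatum L 2 (Matrix.of fun i j : Fin 2 => if i.val + j.val + 1 = 2 then (1 : L) else 0)).Local v,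
    BorelSpace (((cmDatum L 2 (Matrix.of fun i j : Fin 2 => if i.val + j.val + 1 = 2 then (1 : L) else 0)).Local v) ⧸
      Subgroup.centralizer ({γ} : Set ((cmDatum L 2 (Matrix.of fun i j : Fin 2 => if i.val + j.val + 1 = 2 then (1 : L) else 0)).Local v)))]
  (ν : Measure ((cmDatum L 2 (Matrix.of fun i j : Fin 2 => if i.val + j.val + 1 = 2 then (1 : L) else 0)).Local v))
  [IsHaarMeasure ν] [ν.IsMulRightInvariant]

include hw hϖ hσϖ in
/-- **THE (R2) RELATIONS PACKAGE AT A NON-SPLIT PLACE FROM THE ELLIPTIC RELATION AT `K, K′ := Ad_d K, I := K ⊓ K′`** — the per-place hypothesis of ★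
`rankOneEulerPoincareNonsplit_of_relations` at `(L, v)`: given (E) at the three concrete levels for every regular elliptic class (`hE`: e.g. ★ A-p17
`natCard_fixedBy_add_eq_natCard_fixedBy_add_one_congr` instantiated at `(Φ₂)_w`, or `epEllipticRelation_of_typeTwo` below), the package
`∃ K K′ I, open ∧ compact ×3 ∧ (E) ∧ (N)` holds — (N) is ★ B-p10 `epNonEllipticRelation`, open∕compact ★ `isCompact_isOpen_cmLocalIntegralLevel` + ★ p843175 §1.
No unramifiedness is used here (only `ϖ` a `σ_w`-fixed uniformiser of `L_w`). [cite: Kottwitz1988, §2 Theorem 2] [cite: Rogawski1990, §12.6 p. 174] [cite: Serre1980Trees, II.1.1] -/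
theorem exists_epRelations_of_ellipticRelation
    {m : OrbitalMeasureFamily ((cmDatum L 2 (Matrix.of fun i j : Fin 2 => if i.val + j.val + 1 = 2 then (1 : L) else 0)).Local v)}
    (hm : m.IsCanonical (fun γ => IsRegularElt (γ.val : GL (Fin 2) (UnitaryGroup.LocalRing L v))) ν)
    (hE : ∀ γ : (cmDatum L 2 (Matrix.of fun i j : Fin 2 => if i.val + j.val + 1 = 2 then (1 : L) else 0)).Local v,
      IsRegularElt (γ.val : GL (Fin 2) (UnitaryGroup.LocalRing L v)) →
      CompactSpace (Subgroup.centralizer ({γ} : Set ((cmDatum L 2 (Matrix.of fun i j : Fin 2 => if i.val + j.val + 1 = 2 then (1 : L) else 0)).Local v))) →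
      Nat.card (fixedBy ((cmDatum L 2 (Matrix.of fun i j : Fin 2 => if i.val + j.val + 1 = 2 then (1 : L) else 0)).Local v ⧸
          cmLocalIntegralLevel L 2 (Matrix.of fun i j : Fin 2 => if i.val + j.val + 1 = 2 then (1 : L) else 0) v) γ) +
        Nat.card (fixedBy ((cmDatum L 2 (Matrix.of fun i j : Fin 2 => if i.val + j.val + 1 = 2 then (1 : L) else 0)).Local v ⧸
          (cmLocalIntegralLevel L 2 (Matrix.of fun i j : Fin 2 => if i.val + j.val + 1 = 2 then (1 : L) else 0) v).map
            (cmDatumLocalNonsplitCongr L w hw (glDiagonal 2 (w.1.adicCompletion L) ![1, ϖ]) ϖ.isUnit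
              (formCongr_glDiagonal_eq_smul_two L w hw ϖ hσϖ)).toMulEquiv.toMonoidHom) γ) =
        Nat.card (fixedBy ((cmDatum L 2 (Matrix.of fun i j : Fin 2 => if i.val + j.val + 1 = 2 then (1 : L) else 0)).Local v ⧸
          (cmLocalIntegralLevel L 2 (Matrix.of fun i j : Fin 2 => if i.val + j.val + 1 = 2 then (1 : L) else 0) v ⊓
            (cmLocalIntegralLevel L 2 (Matrix.of fun i j : Fin 2 => if i.val + j.val + 1 = 2 then (1 : L) else 0) v).map
              (cmDatumLocalNonsplitCongr L w hw (glDiagonal 2 (w.1.adicCompletion L) ![1, ϖ]) ϖ.isUnit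
              (formCongr_glDiagonal_eq_smul_two L w hw ϖ hσϖ)).toMulEquiv.toMonoidHom)) γ) + 1) :
    ∃ K K' I : Subgroup ((cmDatum L 2 (Matrix.of fun i j : Fin 2 => if i.val + j.val + 1 = 2 then (1 : L) else 0)).Local v),
      IsOpen (K : Set ((cmDatum L 2 (Matrix.of fun i j : Fin 2 => if i.val + j.val + 1 = 2 then (1 : L) else 0)).Local v)) ∧
      IsCompact (K : Set ((cmDatum L 2 (Matrix.of fun i j : Fin 2 => if i.val + j.val + 1 = 2 then (1 : L) else 0)).Local v)) ∧
      IsOpen (K' : Set ((cmDatum L 2 (Matrix.of fun i j : Fin 2 => if i.val + j.val + 1 = 2 then (1 : L) else 0)).Local v)) ∧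
      IsCompact (K' : Set ((cmDatum L 2 (Matrix.of fun i j : Fin 2 => if i.val + j.val + 1 = 2 then (1 : L) else 0)).Local v)) ∧
      IsOpen (I : Set ((cmDatum L 2 (Matrix.of fun i j : Fin 2 => if i.val + j.val + 1 = 2 then (1 : L) else 0)).Local v)) ∧
      IsCompact (I : Set ((cmDatum L 2 (Matrix.of fun i j : Fin 2 => if i.val + j.val + 1 = 2 then (1 : L) else 0)).Local v)) ∧
      (∀ γ : (cmDatum L 2 (Matrix.of fun i j : Fin 2 => if i.val + j.val + 1 = 2 then (1 : L) else 0)).Local v,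
        IsRegularElt (γ.val : GL (Fin 2) (UnitaryGroup.LocalRing L v)) →
        CompactSpace (Subgroup.centralizer
          ({γ} : Set ((cmDatum L 2 (Matrix.of fun i j : Fin 2 => if i.val + j.val + 1 = 2 then (1 : L) else 0)).Local v))) →
        Nat.card (fixedBy ((cmDatum L 2 (Matrix.of fun i j : Fin 2 => if i.val + j.val + 1 = 2 then (1 : L) else 0)).Local v ⧸ K) γ) +
          Nat.card (fixedBy ((cmDatum L 2 (Matrix.of fun i j : Fin 2 => if i.val + j.val + 1 = 2 then (1 : L) else 0)).Local v ⧸ K') γ) =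
          Nat.card (fixedBy ((cmDatum L 2 (Matrix.of fun i j : Fin 2 => if i.val + j.val + 1 = 2 then (1 : L) else 0)).Local v ⧸ I) γ) + 1) ∧
      (∀ γ : (cmDatum L 2 (Matrix.of fun i j : Fin 2 => if i.val + j.val + 1 = 2 then (1 : L) else 0)).Local v,
        IsRegularElt (γ.val : GL (Fin 2) (UnitaryGroup.LocalRing L v)) →
        ¬ CompactSpace (Subgroup.centralizer
          ({γ} : Set ((cmDatum L 2 (Matrix.of fun i j : Fin 2 => if i.val + j.val + 1 = 2 then (1 : L) else 0)).Local v))) →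
        (((ν K).toReal : ℂ))⁻¹ * classOrbitalIntegral m
            ((K : Set ((cmDatum L 2 (Matrix.of fun i j : Fin 2 => if i.val + j.val + 1 = 2 then (1 : L) else 0)).Local v)).indicator fun _ => (1 : ℂ))
            (ConjClasses.mk γ) +
          (((ν K').toReal : ℂ))⁻¹ * classOrbitalIntegral m
            ((K' : Set ((cmDatum L 2 (Matrix.of fun i j : Fin 2 => if i.val + j.val + 1 = 2 then (1 : L) else 0)).Local v)).indicator fun _ => (1 : ℂ))
            (ConjClasses.mk γ) -
          (((ν I).toReal : ℂ))⁻¹ * classOrbitalIntegral m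
            ((I : Set ((cmDatum L 2 (Matrix.of fun i j : Fin 2 => if i.val + j.val + 1 = 2 then (1 : L) else 0)).Local v)).indicator fun _ => (1 : ℂ))
            (ConjClasses.mk γ) = 0) := by
  obtain ⟨hKc, hKo⟩ := isCompact_isOpen_cmLocalIntegralLevel L 2 (Matrix.of fun i j : Fin 2 => if i.val + j.val + 1 = 2 then (1 : L) else 0) v
  obtain ⟨hK'c, hK'o⟩ := isCompact_isOpen_map_cmDatumLocalNonsplitCongr_cmLocalIntegralLevel L w hw ϖ hσϖ
  obtain ⟨hIc, hIo⟩ := isCompact_isOpen_cmLocalIntegralLevel_inf_map L w hw ϖ hσϖ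
  exact ⟨_, _, _, hKo, hKc, hK'o, hK'c, hIo, hIc, hE, epNonEllipticRelation L w hw ϖ hϖ hσϖ ν hm⟩

include hw hϖ hσϖ in
/-- **THE (R2) RELATIONS PACKAGE AT AN UNRAMIFIED NON-SPLIT PLACE, MODULO THE TYPE-(2) COUNT** — the per-place hypothesis of ★
`rankOneEulerPoincareNonsplit_of_relations` at `(L, v)`: there are compact open `K, K′, I ≤ U(Φ₂)(L⁺_v)` (`K = U(Φ₂)(𝒪_v)`, `K′ = Ad_d K`, `I = K ⊓ K′`)
with (E) at every regular elliptic class and (N) at every regular non-elliptic class — (N) ★ B-p10 `epNonEllipticRelation`, (E) by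
`epEllipticRelation_of_typeTwo`. [cite: Kottwitz1988, §2 Theorem 2] [cite: Rogawski1990, §12.6 p. 174] [cite: Serre1980Trees, II.1.1] -/
theorem exists_epRelations_of_typeTwo (hunr : Algebra.IsUnramifiedIn (𝓞 L) v.asIdeal)
    {m : OrbitalMeasureFamily ((cmDatum L 2 (Matrix.of fun i j : Fin 2 => if i.val + j.val + 1 = 2 then (1 : L) else 0)).Local v)}
    (hm : m.IsCanonical (fun γ => IsRegularElt (γ.val : GL (Fin 2) (UnitaryGroup.LocalRing L v))) ν)
    (hE₂ : ∀ γ : (cmDatum L 2 (Matrix.of fun i j : Fin 2 => if i.val + j.val + 1 = 2 then (1 : L) else 0)).Local v,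
      IsRegularElt (γ.val : GL (Fin 2) (UnitaryGroup.LocalRing L v)) →
      CompactSpace (Subgroup.centralizer ({γ} : Set ((cmDatum L 2 (Matrix.of fun i j : Fin 2 => if i.val + j.val + 1 = 2 then (1 : L) else 0)).Local v))) →
      (¬ ∃ x : w.1.adicCompletion L, ((((γ.val : GL (Fin 2) (UnitaryGroup.LocalRing L v)) : Matrix (Fin 2) (Fin 2) (UnitaryGroup.LocalRing L v)).charpoly.map
        (Pi.evalRingHom (fun w' : PlacesOver L v => w'.1.adicCompletion L) w)).IsRoot x)) →
      Nat.card (fixedBy ((cmDatum L 2 (Matrix.of fun i j : Fin 2 => if i.val + j.val + 1 = 2 then (1 : L) else 0)).Local v ⧸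
          cmLocalIntegralLevel L 2 (Matrix.of fun i j : Fin 2 => if i.val + j.val + 1 = 2 then (1 : L) else 0) v) γ) +
        Nat.card (fixedBy ((cmDatum L 2 (Matrix.of fun i j : Fin 2 => if i.val + j.val + 1 = 2 then (1 : L) else 0)).Local v ⧸
          (cmLocalIntegralLevel L 2 (Matrix.of fun i j : Fin 2 => if i.val + j.val + 1 = 2 then (1 : L) else 0) v).map
            (cmDatumLocalNonsplitCongr L w hw (glDiagonal 2 (w.1.adicCompletion L) ![1, ϖ]) ϖ.isUnit
              (formCongr_glDiagonal_eq_smul_two L w hw ϖ hσϖ)).toMulEquiv.toMonoidHom) γ) =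
        Nat.card (fixedBy ((cmDatum L 2 (Matrix.of fun i j : Fin 2 => if i.val + j.val + 1 = 2 then (1 : L) else 0)).Local v ⧸
          (cmLocalIntegralLevel L 2 (Matrix.of fun i j : Fin 2 => if i.val + j.val + 1 = 2 then (1 : L) else 0) v ⊓
            (cmLocalIntegralLevel L 2 (Matrix.of fun i j : Fin 2 => if i.val + j.val + 1 = 2 then (1 : L) else 0) v).map
              (cmDatumLocalNonsplitCongr L w hw (glDiagonal 2 (w.1.adicCompletion L) ![1, ϖ]) ϖ.isUnit
                (formCongr_glDiagonal_eq_smul_two L w hw ϖ hσϖ)).toMulEquiv.toMonoidHom)) γ) + 1) :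
    ∃ K K' I : Subgroup ((cmDatum L 2 (Matrix.of fun i j : Fin 2 => if i.val + j.val + 1 = 2 then (1 : L) else 0)).Local v),
      IsOpen (K : Set ((cmDatum L 2 (Matrix.of fun i j : Fin 2 => if i.val + j.val + 1 = 2 then (1 : L) else 0)).Local v)) ∧
      IsCompact (K : Set ((cmDatum L 2 (Matrix.of fun i j : Fin 2 => if i.val + j.val + 1 = 2 then (1 : L) else 0)).Local v)) ∧
      IsOpen (K' : Set ((cmDatum L 2 (Matrix.of fun i j : Fin 2 => if i.val + j.val + 1 = 2 then (1 : L) else 0)).Local v)) ∧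
      IsCompact (K' : Set ((cmDatum L 2 (Matrix.of fun i j : Fin 2 => if i.val + j.val + 1 = 2 then (1 : L) else 0)).Local v)) ∧
      IsOpen (I : Set ((cmDatum L 2 (Matrix.of fun i j : Fin 2 => if i.val + j.val + 1 = 2 then (1 : L) else 0)).Local v)) ∧
      IsCompact (I : Set ((cmDatum L 2 (Matrix.of fun i j : Fin 2 => if i.val + j.val + 1 = 2 then (1 : L) else 0)).Local v)) ∧
      (∀ γ : (cmDatum L 2 (Matrix.of fun i j : Fin 2 => if i.val + j.val + 1 = 2 then (1 : L) else 0)).Local v,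
        IsRegularElt (γ.val : GL (Fin 2) (UnitaryGroup.LocalRing L v)) →
        CompactSpace (Subgroup.centralizer
          ({γ} : Set ((cmDatum L 2 (Matrix.of fun i j : Fin 2 => if i.val + j.val + 1 = 2 then (1 : L) else 0)).Local v))) →
        Nat.card (fixedBy ((cmDatum L 2 (Matrix.of fun i j : Fin 2 => if i.val + j.val + 1 = 2 then (1 : L) else 0)).Local v ⧸ K) γ) +
          Nat.card (fixedBy ((cmDatum L 2 (Matrix.of fun i j : Fin 2 => if i.val + j.val + 1 = 2 then (1 : L) else 0)).Local v ⧸ K') γ) =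
          Nat.card (fixedBy ((cmDatum L 2 (Matrix.of fun i j : Fin 2 => if i.val + j.val + 1 = 2 then (1 : L) else 0)).Local v ⧸ I) γ) + 1) ∧
      (∀ γ : (cmDatum L 2 (Matrix.of fun i j : Fin 2 => if i.val + j.val + 1 = 2 then (1 : L) else 0)).Local v,
        IsRegularElt (γ.val : GL (Fin 2) (UnitaryGroup.LocalRing L v)) →
        ¬ CompactSpace (Subgroup.centralizer
          ({γ} : Set ((cmDatum L 2 (Matrix.of fun i j : Fin 2 => if i.val + j.val + 1 = 2 then (1 : L) else 0)).Local v))) →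
        (((ν K).toReal : ℂ))⁻¹ * classOrbitalIntegral m
            ((K : Set ((cmDatum L 2 (Matrix.of fun i j : Fin 2 => if i.val + j.val + 1 = 2 then (1 : L) else 0)).Local v)).indicator fun _ => (1 : ℂ))
            (ConjClasses.mk γ) +
          (((ν K').toReal : ℂ))⁻¹ * classOrbitalIntegral m
            ((K' : Set ((cmDatum L 2 (Matrix.of fun i j : Fin 2 => if i.val + j.val + 1 = 2 then (1 : L) else 0)).Local v)).indicator fun _ => (1 : ℂ))
            (ConjClasses.mk γ) -
          (((ν I).toReal : ℂ))⁻¹ * classOrbitalIntegral m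
            ((I : Set ((cmDatum L 2 (Matrix.of fun i j : Fin 2 => if i.val + j.val + 1 = 2 then (1 : L) else 0)).Local v)).indicator fun _ => (1 : ℂ))
            (ConjClasses.mk γ) = 0) :=
  exists_epRelations_of_ellipticRelation L w hw ϖ hϖ hσϖ ν hm (epEllipticRelation_of_typeTwo L w hw ϖ hϖ hσϖ hunr hE₂)

/-! ## §3 The Euler–Poincaré function at a non-split place, in the same two shapes -/

include hw hϖ hσϖ in
/-- **KOTTWITZ'S EULER–POINCARÉ FUNCTION ON `U(Φ₂)(L⁺_v)` FROM THE ELLIPTIC RELATION AT `K, K′, I`**: for every two-sided Haar `ν` and every canonical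
orbital-measure family `m`, (E) at the three concrete levels gives a locally constant compactly supported `f` with `Φ(⟦γ⟧, f) = 1` at every regular
elliptic class and `= 0` at every regular non-elliptic class — the body of the letter ★ `RankOneEulerPoincareNonsplit` at `(L, v, ν, m)` (★ glue
`exists_isLocSmooth_classOrbitalIntegral_eq_one_zero_of_relations_two` over `exists_epRelations_of_ellipticRelation`). [cite: Kottwitz1988, §2 Theorem 2]
[cite: Rogawski1990, §12.6 p. 174; §12.7 Lemma 12.7.1 p. 176] -/
theorem exists_isLocSmooth_classOrbitalIntegral_eq_one_zero_of_ellipticRelation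
    {m : OrbitalMeasureFamily ((cmDatum L 2 (Matrix.of fun i j : Fin 2 => if i.val + j.val + 1 = 2 then (1 : L) else 0)).Local v)}
    (hm : m.IsCanonical (fun γ => IsRegularElt (γ.val : GL (Fin 2) (UnitaryGroup.LocalRing L v))) ν)
    (hE : ∀ γ : (cmDatum L 2 (Matrix.of fun i j : Fin 2 => if i.val + j.val + 1 = 2 then (1 : L) else 0)).Local v,
      IsRegularElt (γ.val : GL (Fin 2) (UnitaryGroup.LocalRing L v)) →
      CompactSpace (Subgroup.centralizer ({γ} : Set ((cmDatum L 2 (Matrix.of fun i j : Fin 2 => if i.val + j.val + 1 = 2 then (1 : L) else 0)).Local v))) →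
      Nat.card (fixedBy ((cmDatum L 2 (Matrix.of fun i j : Fin 2 => if i.val + j.val + 1 = 2 then (1 : L) else 0)).Local v ⧸
          cmLocalIntegralLevel L 2 (Matrix.of fun i j : Fin 2 => if i.val + j.val + 1 = 2 then (1 : L) else 0) v) γ) +
        Nat.card (fixedBy ((cmDatum L 2 (Matrix.of fun i j : Fin 2 => if i.val + j.val + 1 = 2 then (1 : L) else 0)).Local v ⧸
          (cmLocalIntegralLevel L 2 (Matrix.of fun i j : Fin 2 => if i.val + j.val + 1 = 2 then (1 : L) else 0) v).map
            (cmDatumLocalNonsplitCongr L w hw (glDiagonal 2 (w.1.adicCompletion L) ![1, ϖ]) ϖ.isUnit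
              (formCongr_glDiagonal_eq_smul_two L w hw ϖ hσϖ)).toMulEquiv.toMonoidHom) γ) =
        Nat.card (fixedBy ((cmDatum L 2 (Matrix.of fun i j : Fin 2 => if i.val + j.val + 1 = 2 then (1 : L) else 0)).Local v ⧸
          (cmLocalIntegralLevel L 2 (Matrix.of fun i j : Fin 2 => if i.val + j.val + 1 = 2 then (1 : L) else 0) v ⊓
            (cmLocalIntegralLevel L 2 (Matrix.of fun i j : Fin 2 => if i.val + j.val + 1 = 2 then (1 : L) else 0) v).map
              (cmDatumLocalNonsplitCongr L w hw (glDiagonal 2 (w.1.adicCompletion L) ![1, ϖ]) ϖ.isUnit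
              (formCongr_glDiagonal_eq_smul_two L w hw ϖ hσϖ)).toMulEquiv.toMonoidHom)) γ) + 1) :
    ∃ f : (cmDatum L 2 (Matrix.of fun i j : Fin 2 => if i.val + j.val + 1 = 2 then (1 : L) else 0)).Local v → ℂ, IsLocSmooth f ∧
      (∀ γ : (cmDatum L 2 (Matrix.of fun i j : Fin 2 => if i.val + j.val + 1 = 2 then (1 : L) else 0)).Local v,
          IsRegularElt (γ.val : GL (Fin 2) (UnitaryGroup.LocalRing L v)) →
          CompactSpace (Subgroup.centralizer ({γ} : Set ((cmDatum L 2 (Matrix.of fun i j : Fin 2 => if i.val + j.val + 1 = 2 then (1 : L) else 0)).Local v))) →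
          classOrbitalIntegral m f (ConjClasses.mk γ) = 1) ∧
      (∀ γ : (cmDatum L 2 (Matrix.of fun i j : Fin 2 => if i.val + j.val + 1 = 2 then (1 : L) else 0)).Local v,
          IsRegularElt (γ.val : GL (Fin 2) (UnitaryGroup.LocalRing L v)) →
          ¬ CompactSpace (Subgroup.centralizer ({γ} : Set ((cmDatum L 2 (Matrix.of fun i j : Fin 2 => if i.val + j.val + 1 = 2 then (1 : L) else 0)).Local v))) →
          classOrbitalIntegral m f (ConjClasses.mk γ) = 0) := by
  obtain ⟨K, K', I, hKo, hKc, hK'o, hK'c, hIo, hIc, hE', hN⟩ := exists_epRelations_of_ellipticRelation L w hw ϖ hϖ hσϖ ν hm hE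
  exact exists_isLocSmooth_classOrbitalIntegral_eq_one_zero_of_relations_two L v ν hm K K' I hKo hKc hK'o hK'c hIo hIc hE' hN

include hw hϖ hσϖ in
/-- **KOTTWITZ'S EULER–POINCARÉ FUNCTION ON `U(Φ₂)(L⁺_v)` AT AN UNRAMIFIED NON-SPLIT `v`, MODULO THE TYPE-(2) COUNT**: for every two-sided Haar `ν` and
every canonical orbital-measure family `m` there is a locally constant compactly supported `f` with `Φ(⟦γ⟧, f) = 1` at every regular elliptic
class and `= 0` at every regular non-elliptic class — the body of the letter ★ `RankOneEulerPoincareNonsplit` at `(L, v, ν, m)` (★ glue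
`exists_isLocSmooth_classOrbitalIntegral_eq_one_zero_of_relations_two` over `exists_epRelations_of_typeTwo`). [cite: Kottwitz1988, §2 Theorem 2]
[cite: Rogawski1990, §12.6 p. 174; §12.7 Lemma 12.7.1 p. 176] -/
theorem exists_isLocSmooth_classOrbitalIntegral_eq_one_zero_of_typeTwo (hunr : Algebra.IsUnramifiedIn (𝓞 L) v.asIdeal)
    {m : OrbitalMeasureFamily ((cmDatum L 2 (Matrix.of fun i j : Fin 2 => if i.val + j.val + 1 = 2 then (1 : L) else 0)).Local v)}
    (hm : m.IsCanonical (fun γ => IsRegularElt (γ.val : GL (Fin 2) (UnitaryGroup.LocalRing L v))) ν)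
    (hE₂ : ∀ γ : (cmDatum L 2 (Matrix.of fun i j : Fin 2 => if i.val + j.val + 1 = 2 then (1 : L) else 0)).Local v,
      IsRegularElt (γ.val : GL (Fin 2) (UnitaryGroup.LocalRing L v)) →
      CompactSpace (Subgroup.centralizer ({γ} : Set ((cmDatum L 2 (Matrix.of fun i j : Fin 2 => if i.val + j.val + 1 = 2 then (1 : L) else 0)).Local v))) →
      (¬ ∃ x : w.1.adicCompletion L, ((((γ.val : GL (Fin 2) (UnitaryGroup.LocalRing L v)) : Matrix (Fin 2) (Fin 2) (UnitaryGroup.LocalRing L v)).charpoly.map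
        (Pi.evalRingHom (fun w' : PlacesOver L v => w'.1.adicCompletion L) w)).IsRoot x)) →
      Nat.card (fixedBy ((cmDatum L 2 (Matrix.of fun i j : Fin 2 => if i.val + j.val + 1 = 2 then (1 : L) else 0)).Local v ⧸
          cmLocalIntegralLevel L 2 (Matrix.of fun i j : Fin 2 => if i.val + j.val + 1 = 2 then (1 : L) else 0) v) γ) +
        Nat.card (fixedBy ((cmDatum L 2 (Matrix.of fun i j : Fin 2 => if i.val + j.val + 1 = 2 then (1 : L) else 0)).Local v ⧸
          (cmLocalIntegralLevel L 2 (Matrix.of fun i j : Fin 2 => if i.val + j.val + 1 = 2 then (1 : L) else 0) v).map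
            (cmDatumLocalNonsplitCongr L w hw (glDiagonal 2 (w.1.adicCompletion L) ![1, ϖ]) ϖ.isUnit
              (formCongr_glDiagonal_eq_smul_two L w hw ϖ hσϖ)).toMulEquiv.toMonoidHom) γ) =
        Nat.card (fixedBy ((cmDatum L 2 (Matrix.of fun i j : Fin 2 => if i.val + j.val + 1 = 2 then (1 : L) else 0)).Local v ⧸
          (cmLocalIntegralLevel L 2 (Matrix.of fun i j : Fin 2 => if i.val + j.val + 1 = 2 then (1 : L) else 0) v ⊓
            (cmLocalIntegralLevel L 2 (Matrix.of fun i j : Fin 2 => if i.val + j.val + 1 = 2 then (1 : L) else 0) v).map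
              (cmDatumLocalNonsplitCongr L w hw (glDiagonal 2 (w.1.adicCompletion L) ![1, ϖ]) ϖ.isUnit
                (formCongr_glDiagonal_eq_smul_two L w hw ϖ hσϖ)).toMulEquiv.toMonoidHom)) γ) + 1) :
    ∃ f : (cmDatum L 2 (Matrix.of fun i j : Fin 2 => if i.val + j.val + 1 = 2 then (1 : L) else 0)).Local v → ℂ, IsLocSmooth f ∧
      (∀ γ : (cmDatum L 2 (Matrix.of fun i j : Fin 2 => if i.val + j.val + 1 = 2 then (1 : L) else 0)).Local v,
          IsRegularElt (γ.val : GL (Fin 2) (UnitaryGroup.LocalRing L v)) →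
          CompactSpace (Subgroup.centralizer ({γ} : Set ((cmDatum L 2 (Matrix.of fun i j : Fin 2 => if i.val + j.val + 1 = 2 then (1 : L) else 0)).Local v))) →
          classOrbitalIntegral m f (ConjClasses.mk γ) = 1) ∧
      (∀ γ : (cmDatum L 2 (Matrix.of fun i j : Fin 2 => if i.val + j.val + 1 = 2 then (1 : L) else 0)).Local v,
          IsRegularElt (γ.val : GL (Fin 2) (UnitaryGroup.LocalRing L v)) →
          ¬ CompactSpace (Subgroup.centralizer ({γ} : Set ((cmDatum L 2 (Matrix.of fun i j : Fin 2 => if i.val + j.val + 1 = 2 then (1 : L) else 0)).Local v))) →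
          classOrbitalIntegral m f (ConjClasses.mk γ) = 0) :=
  exists_isLocSmooth_classOrbitalIntegral_eq_one_zero_of_ellipticRelation L w hw ϖ hϖ hσϖ ν hm
    (epEllipticRelation_of_typeTwo L w hw ϖ hϖ hσϖ hunr hE₂)

end Assembly

end Literature.NumberTheory.Rogawski1990

end
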